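import Summits.CriticalPhenomena.PercolationContinuityZ3.Theorems.PercNearOneGluingNoHeavyQuantFarCycleBlockTransfer
import Summits.CriticalPhenomena.PercolationContinuityZ3.Theorems.PercNearOneGluingNoHeavyQuantFarLayerOneUnicyclicAll
import Summits.CriticalPhenomena.PercolationContinuityZ3.Theorems.PercNearOneGluingNoHeavyQuantFarBlockUnloaded
import HarnessLib

/-!
# QUANT lane R8, front "FAR beyond trees", layer one — **FAR AT LAYER ONE ON EVERY CACTUS** (pendant cycle blocks with any number of
# loaded vertices, any depth), unconditionally

builds on p205010 (kernel theorem, internal audit signed; external expert review pending)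

Support file (`--supports stmt-CriticalPhenomena-4575`), seat `prim-quant-p1` (gen 22); memo
`run/shared/lean/prim/quant/prim-quant-p1-g22/FOR-LEAD-KHUB.md` §6.  Standard axioms; no sorries.

This is `…QuantFarLayerOneCactus` (p1 g19: blocks loaded at ≤ 2 vertices) with the two-hub transfer replaced by the k-HUB TRANSFER
`Block.farLayerOne_cycleBlock` (`…QuantFarCycleBlockTransfer`, resting on p1 g21's law-level `TwoChain.cycDec`).  A list of pendant cycle blocks
(`Block.CDatum`: length `L`, cycle `cyc` through the cut vertex `cyc 0`, hubs `S j` = whatever hangs at `cyc j` — deeper sub-cacti included —, block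
`Z`) is decoupled head first (`Block.cdecoupleAll`): each cycle becomes independent stems `s(cyc 0, cyc j)` at its cut vertex, the hubs ride along;
an earlier block keeps a later one well formed as soon as the two are COMPATIBLE (`Block.CDatum.Compat`: the earlier block's cut vertex and cycle lie
off the later block, or the earlier block sits inside one of its hubs — both nesting orders of a cactus).  Hence
* **`Block.farLayerOne_of_cblocks`** — decoupling a compatible list of well-formed cycle blocks transfers the `j = 1` FAR instance from the fully
  decoupled weights to `w` (any observer off the blocks, any base theorem);
* **`Block.layerOne_of_cactus`** (observer on the root cycle), `Block.layerOne_of_cactus_treeObs` (observer in a pendant tree): if the fully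
  decoupled weights form a pendant forest on a cycle (`Bundle.PForest`) carrying the relays, then for the ORIGINAL weights
  `2 < Σ_a P_w(o ↔ a)` and `P_w(o ↮ a) ≤ t` on `A` imply `P_w(#{a ∈ A : o ↔ a} ≤ 1) ≤ t`.
Every finite cactus (every block a cycle or a bridge) with the observer's block as root is presented this way, block by block; so FAR holds at
layer one on ALL cacti — the k-anchor programme of p1 g19 §6 / g20 / g21 is closed at the graph level.  What is left at layer one: pendant
2-connected cores that are not cycles (p1 g18 §7(b)).  [cite: KozmaNitzan2024, Conjecture 3 (p. 15)] (the row); [this work].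
-/

noncomputable section

namespace Summit.CriticalPhenomena.PercolationContinuityZ3.Theorems

namespace Quant

namespace Block

open Finset MeasureTheory Set
open Literature.Probability.LatticeModels
open Literature.Probability.Percolation
open Bundle (avoid)
open scoped Classical

variable {n : ℕ}

/-- The canonical block of a cycle with hubs: the cycle vertices `cyc j`, `1 ≤ j < L`, and the hubs. [this work] -/
def cycleZ (L : ℕ) (cyc : ℕ → Fin n) (S : ℕ → Finset (Fin n)) : Finset (Fin n) := (cpos L).image cyc ∪ hubs (cpos L) S

/-- **Convenience constructor**: an injective cycle of length `≥ 3` with pairwise disjoint hubs off the cycle is a pendant cycle block on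
`Block.cycleZ`. [this work] -/
theorem isCycleBlock_cycleZ {L : ℕ} {cyc : ℕ → Fin n} {S : ℕ → Finset (Fin n)} (hL : 3 ≤ L)
    (hcyc : ∀ i j, i < L → j < L → cyc i = cyc j → i = j) (hcycS : ∀ i j, i < L → 1 ≤ j → j < L → cyc i ∉ S j)
    (hdisj : ∀ i j, 1 ≤ i → i < L → 1 ≤ j → j < L → i ≠ j → Disjoint (S i) (S j)) : IsCycleBlock L cyc S (cycleZ L cyc S) where
  hL := hL
  hcyc := hcyc
  cZ h := by
    rcases Finset.mem_union.1 h with h | h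
    · obtain ⟨j, hj, hj0⟩ := Finset.mem_image.1 h
      have := hcyc j 0 (mem_cpos.1 hj).2 (by omega) hj0
      exact absurd (mem_cpos.1 hj).1 (by omega)
    · obtain ⟨j, hj, hjS⟩ := mem_hubs.1 h
      exact hcycS 0 j (by omega) (mem_cpos.1 hj).1 (mem_cpos.1 hj).2 hjS
  cycZ j hj1 hjL := Finset.mem_union_left _ (Finset.mem_image_of_mem _ (mem_cpos.2 ⟨hj1, hjL⟩))
  SZ j hj1 hjL x hx := Finset.mem_union_right _ (mem_hubs.2 ⟨j, mem_cpos.2 ⟨hj1, hjL⟩, hx⟩)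
  cycS := hcycS
  disj := hdisj
  Zsub x hx := by
    rcases Finset.mem_union.1 hx with h | h
    · obtain ⟨j, hj, rfl⟩ := Finset.mem_image.1 h
      exact ⟨j, (mem_cpos.1 hj).1, (mem_cpos.1 hj).2, Or.inl rfl⟩
    · obtain ⟨j, hj, hjS⟩ := mem_hubs.1 h
      exact ⟨j, (mem_cpos.1 hj).1, (mem_cpos.1 hj).2, Or.inr hjS⟩

/-- The data of a pendant cycle block with hubs: length `L`, cycle `cyc` (cut vertex `cyc 0`), hubs `S`, block `Z`. [this work] -/
structure CDatum (n : ℕ) where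
  /-- length of the cycle -/
  L : ℕ
  /-- the cycle, `cyc 0` = the cut vertex -/
  cyc : ℕ → Fin n
  /-- what hangs at `cyc j` -/
  S : ℕ → Finset (Fin n)
  /-- the block's vertices (without the cut vertex) -/
  Z : Finset (Fin n)

namespace CDatum

/-- Well-formedness of a cycle block w.r.t. weights `w` and observer `o`. [this work] -/
structure OK (B : CDatum n) (w : Sym2 (Fin n) → unitInterval) (o : Fin n) : Prop where
  blk : IsCycleBlock B.L B.cyc B.S B.Z
  hang : CycleHang B.L B.cyc B.S B.Z w
  obs : o ∉ B.Z

/-- The hub-decoupled weights of one cycle block. [this work] -/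
def dec (B : CDatum n) (w : Sym2 (Fin n) → unitInterval) : Sym2 (Fin n) → unitInterval := cdecouple B.L B.cyc B.S B.Z w

/-- COMPATIBILITY of an earlier block `B` with a later block `B'`: the cut vertex and the cycle of `B` lie off `Z'`, or `B` sits inside a hub of
`B'` (its cut vertex in that hub or at its anchor). [this work] -/
def Compat (B B' : CDatum n) : Prop :=
  (B.cyc 0 ∉ B'.Z ∧ ∀ j, 1 ≤ j → j < B.L → B.cyc j ∉ B'.Z) ∨
  ∃ j, (1 ≤ j ∧ j < B'.L) ∧ (B.cyc 0 ∈ B'.S j ∨ B.cyc 0 = B'.cyc j) ∧ B.Z ⊆ B'.S j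

/-- The stems of a compatible earlier block are not pairs the later block needs to vanish. [this work] -/
theorem Compat.stem_ok {B B' : CDatum n} (hc : Compat B B') (hB : IsCycleBlock B.L B.cyc B.S B.Z) (hB' : IsCycleBlock B'.L B'.cyc B'.S B'.Z)
    {i : ℕ} (hi : 1 ≤ i ∧ i < B.L) {x y : Fin n} (hxy : s(x, y) = s(B.cyc 0, B.cyc i)) :
    ¬ (x ∈ B'.Z ∧ y ∉ B'.Z ∧ y ≠ B'.cyc 0) ∧ (∀ j, 1 ≤ j → j < B'.L → ¬ (x ∈ B'.S j ∧ y ∉ B'.S j ∧ y ≠ B'.cyc j)) ∧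
      ∀ a b, a < B'.L → b < B'.L → s(x, y) ≠ s(B'.cyc a, B'.cyc b) ∨ (a = 0 ∧ b = 0) := by
  have hvZ : B.cyc i ∈ B.Z := hB.cycZ i hi.1 hi.2
  have hxy' : (x = B.cyc 0 ∧ y = B.cyc i) ∨ (x = B.cyc i ∧ y = B.cyc 0) := Sym2.eq_iff.1 hxy
  rcases hc with ⟨hcZ, hcycZ⟩ | ⟨j, hj, hcS, hZS⟩
  · -- `B` outside `B'`
    have hx : x ∉ B'.Z := by rcases hxy' with ⟨rfl, -⟩ | ⟨rfl, -⟩; exacts [hcZ, hcycZ i hi.1 hi.2]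
    have hy : y ∉ B'.Z := by rcases hxy' with ⟨-, rfl⟩ | ⟨-, rfl⟩; exacts [hcycZ i hi.1 hi.2, hcZ]
    refine ⟨fun h => hx h.1, fun j hj1 hjL h => hx (hB'.SZ j hj1 hjL h.1), fun a b ha hb => ?_⟩
    by_cases hab : a = 0 ∧ b = 0
    · exact Or.inr hab
    · left
      intro h
      rcases Sym2.eq_iff.1 h with ⟨h1, h2⟩ | ⟨h1, h2⟩
      · by_cases ha0 : a = 0
        · have hb0 : b ≠ 0 := fun hb0 => hab ⟨ha0, hb0⟩
          exact hy (h2 ▸ hB'.cycZ b (Nat.one_le_iff_ne_zero.2 hb0) hb)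
        · exact hx (h1 ▸ hB'.cycZ a (Nat.one_le_iff_ne_zero.2 ha0) ha)
      · by_cases hb0 : b = 0
        · have ha0 : a ≠ 0 := fun ha0 => hab ⟨ha0, hb0⟩
          exact hy (h2 ▸ hB'.cycZ a (Nat.one_le_iff_ne_zero.2 ha0) ha)
        · exact hx (h1 ▸ hB'.cycZ b (Nat.one_le_iff_ne_zero.2 hb0) hb)
  · -- `B` inside the hub `S' j`
    have hvS : B.cyc i ∈ B'.S j := hZS hvZ
    have hxin : x ∈ B'.S j ∨ x = B'.cyc j := by
      rcases hxy' with ⟨rfl, -⟩ | ⟨rfl, -⟩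
      · exact hcS
      · exact Or.inl hvS
    have hyin : y ∈ B'.S j ∨ y = B'.cyc j := by
      rcases hxy' with ⟨-, rfl⟩ | ⟨-, rfl⟩
      · exact Or.inl hvS
      · exact hcS
    have memZ : ∀ z, z ∈ B'.S j ∨ z = B'.cyc j → z ∈ B'.Z := fun z hz => hz.elim (fun h => hB'.SZ j hj.1 hj.2 h) fun h => h ▸ hB'.cycZ j hj.1 hj.2
    refine ⟨fun h => h.2.1 (memZ y hyin), fun j' hj1 hjL h => ?_, fun a b ha hb => ?_⟩
    · by_cases hjj : j' = j
      · subst hjj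
        rcases hyin with hy | hy
        · exact h.2.1 hy
        · exact h.2.2 hy
      · rcases hxin with hx | hx
        · exact Finset.disjoint_left.1 (hB'.disj j' j hj1 hjL hj.1 hj.2 hjj) h.1 hx
        · exact hB'.cycS j j' hj.2 hj1 hjL (hx ▸ h.1)
    · left
      intro h
      -- one endpoint is `B.cyc i ∈ S' j`, not a cycle vertex of `B'`
      have hvin : B.cyc i = B'.cyc a ∨ B.cyc i = B'.cyc b := by
        have hmem : B.cyc i ∈ s(B'.cyc a, B'.cyc b) := by rw [← h, hxy]; exact Sym2.mem_mk_right _ _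
        exact Sym2.mem_iff.1 hmem
      rcases hvin with h1 | h1
      · exact hB'.cycS a j ha hj.1 hj.2 (h1 ▸ hvS)
      · exact hB'.cycS b j hb hj.1 hj.2 (h1 ▸ hvS)

/-- **Decoupling a compatible earlier block keeps a later block well formed.** [this work] -/
theorem ok_dec_of_compat {B B' : CDatum n} {w : Sym2 (Fin n) → unitInterval} {o : Fin n} (hB : IsCycleBlock B.L B.cyc B.S B.Z)
    (hB' : B'.OK w o) (hc : Compat B B') : B'.OK (B.dec w) o := by
  -- a pair that `w` kills and that is not a stem of `B` is killed by `B.dec w`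
  have key : ∀ x y : Fin n, (w s(x, y) : ℝ) = 0 → (¬ ∃ i, (1 ≤ i ∧ i < B.L) ∧ s(x, y) = s(B.cyc 0, B.cyc i)) → (B.dec w s(x, y) : ℝ) = 0 := by
    intro x y hw0 hns
    by_cases hav : s(x, y) ∈ avoid B.Z
    · rw [CDatum.dec, cdecouple_of_avoid w hav]; exact hw0
    · by_cases hh : ∃ i, (1 ≤ i ∧ i < B.L) ∧ s(x, y) ∈ hubPairs (B.S i) (B.cyc i)
      · obtain ⟨i, hi, he⟩ := hh
        rw [CDatum.dec, cdecouple_hub hB w hi he]; exact hw0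
      · exact cdecouple_zero w hav hns hh
  refine ⟨hB'.blk, ⟨?_, ?_, ?_⟩, hB'.obs⟩
  · intro x y hxy hx hy hyc
    refine key x y (hB'.hang.hangZ x y hxy hx hy hyc) ?_
    rintro ⟨i, hi, h⟩
    exact (hc.stem_ok hB hB'.blk hi h).1 ⟨hx, hy, hyc⟩
  · intro j hj1 hjL x y hxy hx hy hyv
    refine key x y (hB'.hang.hangS j hj1 hjL x y hxy hx hy hyv) ?_
    rintro ⟨i, hi, h⟩
    exact (hc.stem_ok hB hB'.blk hi h).2.1 j hj1 hjL ⟨hx, hy, hyv⟩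
  · intro a b ha hb hab h1 h2
    refine key (B'.cyc a) (B'.cyc b) (hB'.hang.chord a b ha hb hab h1 h2) ?_
    rintro ⟨i, hi, h⟩
    rcases (hc.stem_ok hB hB'.blk hi h).2.2 a b ha hb with h' | ⟨rfl, rfl⟩
    · exact h' rfl
    · exact hab rfl

end CDatum

/-- Hub-decouple a list of cycle blocks in turn (head first). [this work] -/
def cdecoupleAll : List (CDatum n) → (Sym2 (Fin n) → unitInterval) → (Sym2 (Fin n) → unitInterval)
  | [], w => w
  | B :: rest, w => cdecoupleAll rest (B.dec w)

/-- **Decoupling a compatible list of pendant cycle blocks transfers the layer-one FAR instance** (any observer off all blocks): if the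
blocks are well formed for `w`, pairwise compatible in list order, and the `j = 1` FAR instance at `(A, o, t)` holds for the fully decoupled
weights, then it holds for `w`. [this work] -/
theorem farLayerOne_of_cblocks (A : Finset (Fin n)) (o : Fin n) (t : ℝ) :
    ∀ (blocks : List (CDatum n)) (w : Sym2 (Fin n) → unitInterval),
      (∀ B ∈ blocks, B.OK w o) →
      blocks.Pairwise CDatum.Compat →
      ((2 : ℝ) < ∑ a ∈ A, (prodBernoulli (cdecoupleAll blocks w)).real (openConn o a) →
        (∀ a ∈ A, (prodBernoulli (cdecoupleAll blocks w)).real (openConn o a : Set (BondConfig (Fin n)))ᶜ ≤ t) →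
        (prodBernoulli (cdecoupleAll blocks w)).real {ω : BondConfig (Fin n) | (A.filter fun a => ω ∈ openConn o a).card ≤ 1} ≤ t) →
      (2 : ℝ) < ∑ a ∈ A, (prodBernoulli w).real (openConn o a) →
      (∀ a ∈ A, (prodBernoulli w).real (openConn o a : Set (BondConfig (Fin n)))ᶜ ≤ t) →
      (prodBernoulli w).real {ω : BondConfig (Fin n) | (A.filter fun a => ω ∈ openConn o a).card ≤ 1} ≤ t := by
  intro blocks
  induction blocks with
  | nil =>
    intro w _ _ hbase hEN hcut
    exact hbase hEN hcut
  | cons B rest ih =>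
    intro w hOK hpw hbase hEN hcut
    have hB : B.OK w o := hOK B (by simp)
    rw [List.pairwise_cons] at hpw
    obtain ⟨hBrest, hrest⟩ := hpw
    have hOK' : ∀ B' ∈ rest, B'.OK (B.dec w) o := fun B' hB' =>
      CDatum.ok_dec_of_compat hB.blk (hOK B' (List.mem_cons_of_mem _ hB')) (hBrest B' hB')
    by_cases hl : (A ∩ B.Z).Nonempty
    · exact farLayerOne_cycleBlock hB.blk w hB.hang A hB.obs hl t
        (fun hEN' hcut' => ih (B.dec w) hOK' hrest hbase hEN' hcut') hEN hcut
    · -- a relay-free block: re-weighting it changes nothing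
      exact farLayerOne_unloaded w (B.dec w) hB.obs hB.hang.hangZ (cdecouple_hangZ hB.blk w)
        (fun e he => (cdecouple_of_avoid w he).symm) A (fun a ha haZ => hl ⟨a, Finset.mem_inter.2 ⟨ha, haZ⟩⟩) t
        (fun hEN' hcut' => ih (B.dec w) hOK' hrest hbase hEN' hcut') hEN hcut

variable {Lc : ℕ} {cyc : ℕ → Fin n} {idx : Fin n → ℕ} {T : Finset (Fin n)} {par' : Fin n → Fin n} {dep : Fin n → ℕ}

/-- **FAR AT LAYER ONE ON EVERY CACTUS, observer on the root cycle.**  The cycle blocks are well formed for `w`, pairwise compatible in list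
order, and the fully decoupled weights form a pendant forest on a cycle carrying the relays; then for the ORIGINAL weights
`2 < Σ_{a ∈ A} P_w(c₀ ↔ a)` and `P_w(c₀ ↮ a) ≤ t` on `A` imply `P_w(#{a ∈ A : c₀ ↔ a} ≤ 1) ≤ t`. [this work] -/
theorem layerOne_of_cactus (A : Finset (Fin n)) (t : ℝ) (hA' : ∀ a ∈ A, a ∈ T ∨ ∃ i, i < Lc ∧ a = cyc i)
    (blocks : List (CDatum n)) (w : Sym2 (Fin n) → unitInterval) (hOK : ∀ B ∈ blocks, B.OK w (cyc 0))
    (hcompat : blocks.Pairwise CDatum.Compat) (P : Bundle.PForest Lc cyc idx T par' dep (cdecoupleAll blocks w))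
    (hEN : (2 : ℝ) < ∑ a ∈ A, (prodBernoulli w).real (openConn (cyc 0) a))
    (hcut : ∀ a ∈ A, (prodBernoulli w).real (openConn (cyc 0) a : Set (BondConfig (Fin n)))ᶜ ≤ t) :
    (prodBernoulli w).real {ω : BondConfig (Fin n) | (A.filter fun a => ω ∈ openConn (cyc 0) a).card ≤ 1} ≤ t :=
  farLayerOne_of_cblocks A (cyc 0) t blocks w hOK hcompat
    (fun hEN' hcut' => Bundle.layerOne_of_pforest_cycleObs P A hA' t hEN' hcut') hEN hcut

/-- **The same with the observer in a pendant tree of the final presentation** (`par'^[k+1] o = c₀`, chain in `T`, `o` off every block).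
[this work] -/
theorem layerOne_of_cactus_treeObs (A : Finset (Fin n)) (t : ℝ) (hA' : ∀ a ∈ A, a ∈ T ∨ ∃ i, i < Lc ∧ a = cyc i)
    (blocks : List (CDatum n)) (w : Sym2 (Fin n) → unitInterval) {o : Fin n} (hOK : ∀ B ∈ blocks, B.OK w o)
    (hcompat : blocks.Pairwise CDatum.Compat) (P : Bundle.PForest Lc cyc idx T par' dep (cdecoupleAll blocks w))
    {k : ℕ} (hk : par'^[k + 1] o = cyc 0) (hchain : ∀ j, j ≤ k → par'^[j] o ∈ T)
    (hEN : (2 : ℝ) < ∑ a ∈ A, (prodBernoulli w).real (openConn o a))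
    (hcut : ∀ a ∈ A, (prodBernoulli w).real (openConn o a : Set (BondConfig (Fin n)))ᶜ ≤ t) :
    (prodBernoulli w).real {ω : BondConfig (Fin n) | (A.filter fun a => ω ∈ openConn o a).card ≤ 1} ≤ t :=
  farLayerOne_of_cblocks A o t blocks w hOK hcompat
    (fun hEN' hcut' => Bundle.layerOne_of_pforest_treeObs_all P hk hchain A hA' t hEN' hcut') hEN hcut

end Block

end Quant

end Summit.CriticalPhenomena.PercolationContinuityZ3.Theorems
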